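import Mathlib
import HarnessLib
import HarnessLib.Audit
import Summits.Langlands.Statement
import Literature.NumberTheory.GaloisRepresentations.ResidualGaloisRep
import Literature.NumberTheory.GaloisRepresentations.EnormousSubgroup
import Literature.NumberTheory.GaloisRepresentations.DecomposedGeneric
import Literature.NumberTheory.GaloisRepresentations.LabelledHodgeTateWeights
import Literature.NumberTheory.GaloisRepresentations.CrystallineDeformationRing
import HarnessLib.Audit.Status.Attr

/-!
Route: StickelbergerDial

DORMANT since 2026-08-24T17:40:18Z (reconciler: no traction for 6.9 d (last activity statement-claimed at 2026-08-17T18:29:31Z); parked, not closed — `ledger route dormant route-Langlands-StickelbergerDial --off` to reactivate) — unstaffed, not closed; items shared with open routes are served there. `ledger route dormant <id> --off` reactivates.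

# Route StickelbergerDial — non-ordinary weight-zero potential automorphy over CM by unramified
Fermat-disc matching

It suffices to show X = WeightZeroNonOrdinaryPA (plus the junction SectorComplement : X → Langlands
for the rest of the summit): for every
CM field K, finite K^av/K, n ≥ 2, prime ℓ > n² with 2n < ℓ and ℓ UNRAMIFIED in K, ι : ℚ̄_ℓ ≃ ℂ and
every continuous r : Γ_K → GL_n(ℚ̄_ℓ)
that is unramified almost everywhere, CRYSTALLINE at every v ∣ ℓ (pinned Fontaine datum) with
labelled Hodge–Tate weights {0,1,…,n−1} at
every embedding, and residually absolutely irreducible, decomposed generic, enormous on Γ_K(ζ_ℓ),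
with a scalar ρ̄(σ), σ ∉ Γ_K(ζ_ℓ)
(exactly Qian 2023 Thm 1.4's hypotheses with "ordinary" DELETED and "crystalline weight 0, ℓ
unramified" in its place), there is a
finite Galois CM extension K'/K, linearly disjoint from K^av, with ℓ unramified in K', over which r
is automorphic of weight zero:
r|Γ_K' has the Harris–Lan–Taylor–Thorne characterising property of r_ι(Π) for a cuspidal Π of
GL_n(𝔸_K') of weight 0 unramified
above ℓ. The ordinary case is Qian2022 Thm 1.4; the content is the NON-ORDINARY case, for which no
potential-automorphy theorem is in
print for non-polarizable r (SelfDefeatingInduction records "a Fontaine–Laffaille single-ρ potential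
automorphy theorem — a different
route if ever" as wanted and unclaimed). No card realised (barrier-inversion seat; the spine is the
new barrier defn-FamilyWitnessConsecutiveWeights).
Lean: `∀ (K : Type) [Field K] [NumberField K], NumberField.IsCMField K → ∀ (Kav : Type) [Field Kav]
[Algebra K Kav], FiniteDimensional K Kav → ∀ (n : ℕ), 2 ≤ n → ∀ (ℓ : ℕ) [Fact ℓ.Prime], n ^ 2 < ℓ →
2 * n < ℓ → Algebra.IsUnramifiedIn (NumberField.RingOfIntegers K) (Ideal.span {(ℓ : ℤ)}) → ∀ (ι :
PadicAlgCl ℓ ≃+* ℂ) (r : Literature.NumberTheory.GaloisRepresentations.FramedGaloisRep K (PadicAlgCl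
ℓ) n) (τ : Field.absoluteGaloisGroup K →* GL (Fin n)
(Literature.NumberTheory.GaloisRepresentations.padicAlgClResidueField ℓ)), (∀ᶠ v in cofinite,
r.IsUnramifiedAt v) → (∀ (v : IsDedekindDomain.HeightOneSpectrum (NumberField.RingOfIntegers K)) (hv
: ((ℓ : ℕ) : NumberField.RingOfIntegers K) ∈ v.asIdeal), let D :=
Literature.NumberTheory.PAdicHodge.fontainePstAdicCompletion v ℓ hv; D.IsCrystallineFramed
(r.toLocal v) ∧ (letI := D.algebra; ∀ τ' : v.adicCompletion K →ₐ[ℚ_[ℓ]] PadicAlgCl ℓ,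
r.labelledHodgeTateWeightsAt v D.algebra D.𝔅 τ'.toRingHom = (Multiset.range n).map fun i : ℕ => (i :
ℤ))) → r.IsResidualRepOf (RingHom.id _) τ →
Literature.NumberTheory.GaloisRepresentations.IsAbsIrreducible τ →
Literature.NumberTheory.GaloisRepresentations.IsDecomposedGeneric τ →
Literature.NumberTheory.GaloisRepresentations.IsAbsIrreducible (τ.comp
(Literature.NumberTheory.GaloisRepresentations.absGaloisGroupAdjoinRootsOfUnity K ℓ).subtype) →
Literature.NumberTheory.GaloisRepresentations.Subgroup.IsEnormous
((Literature.NumberTheory.GaloisRepresentations.absGaloisGroupAdjoinRootsOfUnity K ℓ).map τ) → (∃ σ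
: Field.absoluteGaloisGroup K, σ ∉
Literature.NumberTheory.GaloisRepresentations.absGaloisGroupAdjoinRootsOfUnity K ℓ ∧ ∃ c :
Literature.NumberTheory.GaloisRepresentations.padicAlgClResidueField ℓ, (τ σ).1 = c • 1) → ∃ (K' :
Type) (_ : Field K') (_ : NumberField K') (_ : Algebra K K'), IsGalois K K' ∧ NumberField.IsCMField
K' ∧ IsField (TensorProduct K Kav K') ∧ Algebra.IsUnramifiedIn (NumberField.RingOfIntegers K')
(Ideal.span {(ℓ : ℤ)}) ∧ ∃ (hcpt' : _) (Pi :
Literature.NumberTheory.Automorphic.CuspidalAutomorphicRepData n K' hcpt'), Pi.1.HasWeightZero ∧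
Literature.NumberTheory.Automorphic.HarrisLanTaylorThorne2016.IsCompatible Pi.1 ι (r.restrictField
K') ∧ ∀ w : IsDedekindDomain.HeightOneSpectrum (NumberField.RingOfIntegers K'), ((ℓ : ℕ) :
NumberField.RingOfIntegers K') ∈ w.asIdeal → Pi.1.IsUnramifiedAt w`
(Rev 1–4, route-repair 2026-08-17: in the route FILE the HLTT predicate
`HarrisLanTaylorThorne2016.IsCompatible` shown by name in this Lean line is WRITTEN OUT over
facts-free vocabulary — for every rational prime q ≠ ℓ above which Π is unramified and every w ∣ q,
r|Γ_K' is unramified at w with the Frobenius characteristic polynomial `arithFrobPolyOfSatake ι q_w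
n α` predicted by Π's Satake parameter α — definitionally equal, `Iff.rfl`; see NUMBERS/CONE.)

## Assembly
Pure logic (Sketch.lean `target_of`, `closes_rehearsal`, lean check rc 0, no sorry):
UnramifiedFermatWitness hands, over K', exactly the
hypotheses of FLLiftingWeightZero (= ACC+ Thm 6.1.1 at weight 0, written out; definitionally the
tree's named fact) for ρ := r|Γ_K' (restrictField); it returns Π of weight 0, HLTT-compatible with
r|Γ_K', unramified above ℓ — which is X's conclusion; SectorComplement carries X to the summit
constant. closes : UnramifiedFermatWitness →
FLLiftingWeightZero → SectorComplement → Langlands := hJ (target derived inline).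

Rationale: WHY THIS LINE. BARRIER-INVERSION. Every printed potential-automorphy engine reaches a non-ordinary
target only through a WEIGHT/COMPONENT-CHANGING device
(Hida families: HSBT doi:10.4007/annals.2010.171.779, Qian2022 Thm 1.4, ACCGHLNSTT2023 Thm 6.1.2;
potential diagonalizability + Harris
tensor alignment under "highly ramified base changes": BarnetlambEtAl2014 Thm 4.2.1, POLARIZABLE
only; Serre-weight cycling), and for
non-polarizable r the only same-weight engine is ACCGHLNSTT2023 Thm 6.1.1 (Calegari–Geraghty
patching; p UNRAMIFIED, crystalline FL,
witness of the SAME labelled weights, tree fact automorphyLifting_crystalline_weightZero). The new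
catalogue candidate
defn-FamilyWitnessConsecutiveWeights (Griffiths transversality ⇒ a connected family with
C-irreducible monodromy has gap-free Hodge
numbers ⇒ family-built witnesses have CONSECUTIVE weights) says weight 0 is exactly the cell where a
Dwork-family witness CAN meet 6.1.1 —
provided the Moret-Bailly point keeps ℓ unramified, i.e. the family must realise the non-ordinary
residual type r̄|Γ_K_v at an
UNRAMIFIED local point instead of killing it by ramified base change (BarnetlambEtAl2014 p.4, Thm
3.1.2: "r̄|G_F_u trivial"). LEVER
(the Stickelberger dial): the reduction of the Fermat χ-piece V_0 at a place above ℓ ∤ N is a sum of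
Jacobi-sum characters whose
inertial digits are given by Stickelberger's theorem as a function of the ⟨ℓ⟩-orbits on (ℤ/N)^×
(Washington1997 §6.1–6.2, IrelandRosen1990
Ch. 8/11/14, Katz2009 for the χ-pieces of the Dwork family): choosing the auxiliary cyclotomic level
N by the multiplicative-order
pattern of ℓ mod N realises a PRESCRIBED non-ordinary (higher-niveau) inertial type of weights
{0,…,n−1}; ℓ-adic local constancy
(t ≡ 0 mod ℓ^m, good reduction ⇒ V̄_t ≅ V̄_0 crystalline of weight 0) and Moret-Bailly with the
local field E'_v/K_v prescribed
UNRAMIFIED (BarnetlambEtAl2014 Prop 3.1.1) then give the witness with ℓ unramified in K', and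
Qian2022 §3–4 supplies the non-self-dual
χ, the SL_n×SL_n monodromy/connectivity and the ℓ'-side ordinary partner. Imported: cyclotomic
arithmetic (Stickelberger), Hodge theory
(the barrier), CG patching (by name). Calibration: n = 2 is Taylor's supersingular disc (Taylor2006
and "Remarks on a conjecture of
Fontaine and Mazur", JIMJ 2002) run over CM fields with 6.1.1; n ≥ 3 is the content. What prior
routes do not: LiftDescend.PotentialAutomorphy
is the ∀F ∀ρ statement with no mechanism for this cell; SelfDefeatingInduction CONSUMES Qian's
ordinary theorem; WachComponentCensus changes
components (GL₂, polarizable); negatives index (3 typing refutations) untouched.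

RANKED CRUXES. #0 WeightZeroNonOrdinaryPA (target) — X as in § Thesis — single-r potential
automorphy in weight zero over CM fields without ordinarity (Qian 2023 Thm 1.4 with (ii) replaced by
crystalline weight 0, ℓ > n² unramified), conclusion in the HLTT characterising form over a CM
Galois K' with ℓ unramified in K'. (why it might fail: a non-ordinary r̄|Γ_K_v (typically
irreducible of niveau n) may be matched by NO fibre of any admissible non-self-dual Dwork family
over an unramified extension of K_v; then every engine needs ℓ ramified in K' and 6.1.1 is
unusable.) [Qian2022, ACCGHLNSTT2023, BarnetlambEtAl2014, Taylor2006]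
#2 UnramifiedFermatWitness (crux) — THE DOOR — ℓ-unramified potential residual automorphy in weight
zero, delivered as the hypothesis bundle (1)–(5) of ACC+ Thm 6.1.1 (weight 0): under X's hypotheses
there are a finite Galois CM K'/K, linearly disjoint from K^av, with ℓ UNRAMIFIED in K', a
compactness witness hcpt', a residual representation τ' of r|Γ_K' that is absolutely irreducible,
decomposed generic, enormous on Γ_K'(ζ_ℓ) with a scalar element off it, the transported analytic
hypotheses (r|Γ_K' a.e. unramified, crystalline of labelled weights {0,…,n−1} at every w ∣ ℓ), and a
WITNESS: a cuspidal π of GL_n(𝔸_K') of weight 0, unramified above ℓ, and a framed r₀ with the HLTT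
property of r_ι(π) whose residual representation is τ' (mechanism: Stickelberger dial at the Fermat
point + ℓ-adic local constancy + Moret-Bailly with unramified E'_v + Qian's ℓ'-switch). [difficulty:
L] (why it might fail: the Stickelberger types of Fermat χ-pieces (as N, χ vary with ℓ ∤ N, χ
non-self-dual à la Qian) may miss some semisimple niveau-n inertial types of digits {0,…,n−1}, and
NON-semisimple r̄|Γ_K_v are not reached at t ≡ 0; enormous/decomposed-generic may not survive Qian's
K'.) [Qian2022, Katz2009, Washington1997, IrelandRosen1990, BarnetlambEtAl2014, ACCGHLNSTT2023,
doi:10.4007/annals.2010.171.779]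
#9 FLLiftingWeightZero (support) — ACC+ 2023 Thm 6.1.1 at weight zero (Fontaine–Laffaille automorphy
lifting for GL_n over CM or totally real F, p > n² unramified) — the tree's named fact
ACCGHLNSTT2023.automorphyLifting_crystalline_weightZero WRITTEN OUT as the route's own open support
obligation (definitionally equal, Iff.rfl; rev 1); closes by `exact …_holds` once the fact is
discharged, `blocked-on:` it until then; needs-fact. [difficulty: open-problem] [ACCGHLNSTT2023]
#9 SectorComplement (crux) — the junction X → Langlands: everything in the summit outside the
weight-zero non-ordinary CM potential-automorphy cell (descent from K' to K and Serre-type residual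
automorphy, other weights — blocked for family methods by defn-FamilyWitnessConsecutiveWeights —,
irregular π, non-CM F, direction (A), local–global compatibility at every place, the reciprocity
data 𝓡). Not this route's business; filed so that closes ends in the summit constant (same pattern
as AnalyticDescent.SectorComplement, EisensteinGelfandKirillov.SectorComplement,
WachComponentCensus.SliceToLanglands). [deps: WeightZeroNonOrdinaryPA] [difficulty: open-problem]
(why it might fail: it is the rest of GL_n reciprocity: fails if (A) fails for an irregular π or (B)
fails beyond the regular CM world while X holds; in particular potential ⇒ actual automorphy over K
needs insoluble descent (SolvableImageBarrier).) [BuzzardGeeLMS2014, FontaineMazurGeometric1995,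
Calegari2023, ACCGHLNSTT2023]

TWO-LAYER PLAN. UnramifiedFermatWitness ⇐ FermatInertialDial (for every semisimple inertial type of
digits {0,…,n−1} at v there are N prime to ℓ and a
Qian-admissible χ with the Fermat χ-piece of that type over K_v^nr) → UnramifiedMoretBaillyLink
(BLGGT Prop 3.1.1 with E'_v unramified +
Qian §4 ℓ'-switch + transport of hypotheses to K') → UnramifiedFermatWitness (k = 2, depth 1); n = 2
calibration rung (Legendre family)
as a support child. Nothing filed now.

KILL CRITERIA. (K1) A printed potential-automorphy theorem for a single NON-ordinary non-polarizable
r over a CM field (any weight) ⇒ novelty gone: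
re-file X as a Literature fact and close superseded. (K2) A computation (n = 3, N = 4 quartic Dwork
pencil with Qian's χ, a few ℓ ≡ 3 mod 4)
showing the niveau-3 inertial type of digits {0,1,2} is realised by NO admissible (N, χ) ⇒
UnramifiedFermatWitness false as stated for
irreducible r̄|Γ_K_v: restate to the realised types (dormant if the realised set is thin) or close
refuted:UnramifiedFermatWitness. (K3) A
refuter showing enormous/decomposed-generic cannot be kept along Qian's K' for 6.1.1 ⇒ pivot to the
Miagkov–Thorne "adequate" version.
X proved elsewhere (e.g. a Caraiani–Newton-type torsion local–global compatibility beyond FL giving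
a PD-lifting for GL_n/CM) moots the route.

NOT DECOMPOSED YET. The dial lemma (Stickelberger digits of Jacobi-sum characters of the χ-piece; a
Literature fact about Fermat motives), the ℓ-adic local
constancy of V̄_t near t = 0, the unramified Moret-Bailly variant, the transport of
decomposed-genericity/enormous image to K', and the
ℓ'-side (ordinary partner + compatible system) — all layer-2 children of UnramifiedFermatWitness;
non-semisimple r̄|Γ_K_v (other discs of
the pencil) deliberately excluded from the first attack; descent K' → K (other routes: LiftDescend,
AnalyticDescent).

CHEAPEST FALSIFIER. (i) Literature: search "potential automorphy" +
"non-ordinary"/"Fontaine–Laffaille" + "single representation" + CM (ran arXiv/zbMATH on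
2026-08-17: 1 hit, arXiv:2405.02970 — compatible systems in rank 3 via Qian + ordinary primes, NOT
single non-ordinary r; Qian2022 Thm 1.4
read: ordinary required). (ii) In-tree/kit: tabulate, for n = 3 and ℓ ∈ {7, 11, 19}, the
Stickelberger digit tables of the rank-3
χ-pieces of X₁⁴+X₂⁴+X₃⁴+X₄⁴ = 4tX₁X₂X₃X₄ at t = 0 for all Qian-admissible χ and compare with the 6
semisimple inertial types of digits
{0,1,2} — one afternoon of pari; not run this cycle (lit search daemon down; recorded for the
refuter).

NUMBERS. ℓ > n² and 2n < ℓ (ACC+ 6.1.1 (4),(5a) at weight 0); semisimple inertial types of digits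
{0,1,2} over K_v^nr for n = 3: 6 (ordinary 1+1+1;
three 1+Ind ω₂ splittings; two niveau-3 cycles); Dwork level in HSBT/Qian: N = n+1 (quartic K3
pencil for n = 3); items at open: 5. CONE (route-repair 2026-08-17,
rrepair-Langlands-StickelbergerDial-8277bbc5): imports = [GaloisRepresentations.ResidualGaloisRep,
.EnormousSubgroup, .DecomposedGeneric, .LabelledHodgeTateWeights, .CrystallineDeformationRing] on
top of the gate-mandated Summits.Langlands.Statement. Dropped:
Automorphic.ACCAutomorphyLiftingCrystalline — it imports ReciprocityGLnProofs.lean, whose holds-free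
XL facts HarrisLanTaylorThorne2016.theoremA_existence, theoremA_uniqueness,
Varma2024.corollary93_unramified rode into the module cone though no item uses them (only the
PREDICATE HarrisLanTaylorThorne2016.IsCompatible, which unfolds to
ReciprocityGLn/AutomorphicRepsGL/GaloisRep vocabulary). The three items naming IsCompatible or the
ACC constant (WeightZeroNonOrdinaryPA, UnramifiedFermatWitness, FLLiftingWeightZero) were restated
1:1, DEFINITIONALLY EQUAL to rev 0 (planner EquivCheck/EquivCheck2.lean: Old ↔ New := Iff.rfl;
FLLiftingWeightZero ↔ ACCGHLNSTT2023.automorphyLifting_crystalline_weightZero := Iff.rfl; lean rc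
0); the crux uses `let k/H/H'` (𝔽̄, Γ_K(ζ_ℓ), Γ_K'(ζ_ℓ)) to stay under the 4000-char cap. Every
intermediate state and the trimmed-import file were mock-rendered (lean rc 0, closes unchanged,
standard axioms). Route-attributable holds-free module-cone facts 4 → 0; gate decl-cone 1 unproved
(cite_only)/459 → 0/455. needs-fact:
Literature.NumberTheory.Automorphic.ACCGHLNSTT2023.automorphyLifting_crystalline_weightZero — ONE,
genuinely load-bearing (it IS FLLiftingWeightZero = hypothesis hF of closes). NOT needed:
theoremA_existence, theoremA_uniqueness, corollary93_unramified (r₀ and Π carry the HLTT property as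
hypothesis/conclusion, never produced from Thm A). The ~11 other holds-free facts of the module cone
enter through Summits.Langlands.Statement (operator-owned, shared by every Langlands route,
hypotheses of no item; cf. PhantomRMYoshida CONE note). The payload's cone views
run/shared/views/cone/Langlands.* were absent from this seat's jail; counts are from the gate's deps
stamp + a bounded read of import lines. Item ids now: target 18031, crux 18025, support 18016,
SectorComplement 17964; the crux's BC3 birth skeleton is evidence on the superseded id
stmt-Langlands-17962 and applies verbatim; Cruxes/ skeletons naming IsCompatible must import
ReciprocityGLnProofs themselves.

DEFINITION REQUESTS. Filed: defn-HLTTCompatible (2026-08-17, relocation not new maths: move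
IsUnramifiedAbove / IsGaloisCompatibleAt / HarrisLanTaylorThorne2016.IsCompatible + proved API out
of ReciprocityGLnProofs.lean into a facts-free module, so the ACC fact file, IsAutomorphicAE and
routes can name the HLTT property without the three XL facts in their cone);
defn-FamilyWitnessConsecutiveWeights (Literature/Barriers/Langlands — the barrier theorem this route
inverts; provable now from
Griffiths transversality, CMSP 2017 Cor 4.5.8). Wanted later (not filed): Fermat/Dwork χ-piece
Galois representations and their
Stickelberger inertial types (Literature/NumberTheory/GaloisRepresentations) to type the layer-2
dial lemma; a general-weight
`HasWeight λ` predicate is NOT needed (weight 0 by design).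

Novelty: Searches (2026-08-17): `lit search --source arxiv "potential automorphy non-self-dual"` (1:
arXiv:2405.02970 Miagkov, rank-3 compatible
systems via ordinary primes); `lit search --source arxiv "potential automorphy for GL_n Qian"` (0
remote; held paper:qian2022 read pp.1–4,
20–26: Thm 1.1/1.4 ordinary, Dwork weights consecutive, K' ramified at ℓ via v(t) < 0); `lit read
paper:arxiv-1010.2561` pp.4, 21, 25–26
(BLGGT: Harris trick + PD, "highly ramified base changes", Prop 3.1.1 Moret-Bailly with prescribed
E'_v, Thm 3.1.2 weight 0 Steinberg,
Thm 4.2.1 polarizable); `lit read paper:arxiv-1812.09999` pp.102–105 (ACC+ applications use ordinary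
ℓ); `lit vsearch` on VHS gap-freeness
(CMSP 2017 pp.148–150); `lit galaxy search "Potential automorphy and change of weight" --star pdf`
(2 unrelated); zbMATH "potential automorphy
Fontaine-Laffaille non-ordinary" (0); tree: lean search potentialAutomorphy/Qian/Dwork (facts
Qian2022.potentialAutomorphy_ordinary,
ACCGHLNSTT2023.automorphyLifting_crystalline_weightZero; no Dwork Galois objects); 87 thesis files +
132 cards grepped for Moret-Bailly /
Serre weight / Griffiths (versal-torsor card: rational torsors, different object). OpenAlex/S2
rate-limited, local FTS daemon down (noted).
Nearest prior art found: Qian2022 (arXiv:2104.09761) Thm 1.4 — single-r potential automorphy over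
CM, ORDINARY, via t → ∞ and ramified K';
BarnetlambEtAl2014 Thm 4.2.1 — non-ordinary via PD but polarizable; Taylor2006 / Taylor JIMJ 2002 —
the supersingular dis  [refs: 2405.02970, 2104.09761, paper:qian2022, paper:arxiv-1010.2561, paper:arxiv-1812.09999, Qian2022, ACCGHLNSTT2023, BarnetlambEtAl2014, Taylor2006]

Barriers (technique_class: potential-automorphy dwork-family fl-lifting): - technique_class: potential-automorphy dwork-family fl-lifting
- Literature.Barriers.Langlands.PatchingLocalComponentBarrier: escaped hypothesis "lift on the same
component as a known automorphic point": the witness r₀ is BORN crystalline of weight 0 at an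
unramified ℓ, on r's own Fontaine–Laffaille deformation ring (formally smooth, one component) — no
component change, no potential diagonalizability, no Harris alignment is used.
- Literature.Barriers.Langlands.TaylorWilesNumericalCoincidence: not evaded, used by name through
evasion (ii): ACC+ Thm 6.1.1 is Calegari–Geraghty patching in positive defect (the vendored fact
FLLiftingWeightZero); the route adds nothing to lifting.
- Literature.Barriers.Langlands.TwistedEndoscopySelfDual: escaped via Qian's self-duality-breaking χ
(monodromy SL_n, not Sp/O) and the non-self-dual lifting theorem; no descent to a unitary group
occurs.
- Literature.Barriers.Langlands.ResiduallyReducibleBarrier: not evaded; absolute irreducibility,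
decomposed genericity and enormous image are HYPOTHESES of X (as in Qian 1.4 / ACC+ 6.1.1).
- Literature.Barriers.Langlands.ModPLanglandsGL2BeyondQpFpBar: not met: ℓ > n², ℓ unramified,
Fontaine–Laffaille range — no p-adic or mod-p local Langlands input at v ∣ ℓ (the FL torsion
local–global compatibility of ACC+ §4 / CaraianiNewton2023 is inside the named fact).
- Literature.Barriers.Langlands.SolvableImageBarrier: not claimed to be evaded: X is POTENTIAL
automorphy over a CM Galois K'; descent to K is le

History (route lifecycle, newest last):
- 2026-08-17T06:46:48Z · rev 1: restated FLLiftingWeightZero (stmt-Langlands-17963) — route-repair (cone, rrepair-8277bbc5) 1/4: restate support FLLiftingWeightZero 1:1 — the named fact ACC+ Thm 6.1.1 (weight 0) WRITTEN OUT, definitionally equal (planner-rrepair-Langlands-StickelbergerDial-8277bbc5-0)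
- 2026-08-17T06:50:50Z · rev 2: restated UnramifiedFermatWitness (stmt-Langlands-17962) — route-repair (cone, rrepair-8277bbc5) 2/4: restate crux UnramifiedFermatWitness 1:1, DEFINITIONALLY EQUAL to rev 0/1 (planner EquivCheck2.lean Iff.rfl, lean rc (planner-rrepair-Langlands-StickelbergerDial-8277bbc5-0)
- 2026-08-17T06:52:42Z · rev 3: restated WeightZeroNonOrdinaryPA (stmt-Langlands-17961) — route-repair (cone, rrepair-8277bbc5) 3/4: restate target WeightZeroNonOrdinaryPA 1:1, DEFINITIONALLY EQUAL to rev 0 (planner EquivCheck.lean / EquivCheck2.lean (planner-rrepair-Langlands-StickelbergerDial-8277bbc5-0)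
- 2026-08-24T17:40:18Z · DORMANT — reconciler: no traction for 6.9 d (last activity statement-claimed at 2026-08-17T18:29:31Z); parked, not closed — `ledger route dormant route-Langlands-Stickelb (operator:999:3993764)

sub-problem: Langlands · status: dormant · opened planner-plan-novel-Langlands-Langlands-e266a39d-c-v2-g12-0 2026-08-17T06:04:41Z · rev 4 · ledger route-Langlands-StickelbergerDial
GENERATED by the gate from the ledger (D-0016/17). Provers cite these decls: `theorem foo : Summit.Langlands.Langlands.Theses.StickelbergerDial.<Decl> := …` in Summits/Langlands/Langlands/Theorems/<Name>.lean.
-/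

namespace Summit.Langlands.Langlands.Theses.StickelbergerDial

open scoped BigOperators Topology Manifold Classical MeasureTheory ProbabilityTheory Matrix InnerProductSpace ComplexConjugate ContinuousMap
open Filter Set Function TopologicalSpace MeasureTheory

attribute [summit_statement] _root_.Langlands

-- earlier WeightZeroNonOrdinaryPA (stmt-Langlands-17961, replaced 2026-08-17T06:52:42Z -> stmt-Langlands-18031): retired by None — ∀ (K : Type) [Field K] [NumberField K], NumberField.IsCMField K → ∀ (Kav : Type) [Field Kav] [Algebra K Kav], FiniteDimensional K Kav → ∀ (n : ℕ), 2 ≤ n → ∀ (ℓ : ℕ) [Fact ℓ.Prime], n ^ 2 < ℓ → 2 * n < ℓ → Algebra.IsUnramifiedIn (NumberField.RingOfIntegers K) (Ideal.span 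
/-- item stmt-Langlands-18031 · target · rank 0 · open · by planner
why it might fail: a non-ordinary r̄|Γ_K_v (typically irreducible of niveau n) may be matched by NO fibre of any admissible non-self-dual Dwork family over an unramified extension of K_v; then every engine needs ℓ ramified in K' and 6.1.1 is unusable.
sources: Qian2022, ACCGHLNSTT2023, BarnetlambEtAl2014, Taylor2006
[target] X as in § Thesis — single-r potential automorphy in weight zero over CM fields without
ordinarity (Qian 2023 Thm 1.4 with (ii) replaced by crystalline weight 0, ℓ > n² unramified),
conclusion in the HLTT characterising form over a CM Galois K' with ℓ unramified in K'. (rev 1,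
route-repair 2026-08-17: the HLTT predicate `HarrisLanTaylorThorne2016.IsCompatible Pi.1 ι (r|Γ_K')`
is WRITTEN OUT over facts-free vocabulary — for every rational prime q ≠ ℓ above which Π is
unramified and every w ∣ q, r|Γ_K' is unramified at w with the Frobenius characteristic polynomial
predicted by Π's Satake parameter; definitionally equal to rev 0, `Iff.rfl`.) -/
@[route_item "route-Langlands-StickelbergerDial"]
def WeightZeroNonOrdinaryPA : Prop :=
  ∀ (K : Type) [Field K] [NumberField K], NumberField.IsCMField K → ∀ (Kav : Type) [Field Kav] [Algebra K Kav], FiniteDimensional K Kav → ∀ (n : ℕ), 2 ≤ n → ∀ (ℓ : ℕ) [Fact ℓ.Prime], n ^ 2 < ℓ → 2 * n < ℓ → Algebra.IsUnramifiedIn (NumberField.RingOfIntegers K) (Ideal.span {(ℓ : ℤ)}) → ∀ (ι : PadicAlgCl ℓ ≃+* ℂ) (r : Literature.NumberTheory.GaloisRepresentations.FramedGaloisRep K (PadicAlgCl ℓ) n) (τ : Field.absoluteGaloisGroup K →* GL (Fin n) (Literature.NumberTheory.GaloisRepresentations.padicAlgClResidueField ℓ)), (∀ᶠ v in cofinite,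 r.IsUnramifiedAt v) → (∀ (v : IsDedekindDomain.HeightOneSpectrum (NumberField.RingOfIntegers K)) (hv : ((ℓ : ℕ) : NumberField.RingOfIntegers K) ∈ v.asIdeal), let D := Literature.NumberTheory.PAdicHodge.fontainePstAdicCompletion v ℓ hv; D.IsCrystallineFramed (r.toLocal v) ∧ (letI := D.algebra; ∀ τ' : v.adicCompletion K →ₐ[ℚ_[ℓ]] PadicAlgCl ℓ, r.labelledHodgeTateWeightsAt v D.algebra D.𝔅 τ'.toRingHom = (Multiset.range n).map fun i : ℕ => (i : ℤ))) → r.IsResidualRepOf (RingHom.id _) τ → Literature.NumberTheory.GaloisRepresentations.IsAbsIrreducible τ → Literature.NumberTheory.GaloisRepresentations.IsDecomposedGeneric τ → Literature.NumberTheory.GaloisRepresentations.IsAbsIrreducible (τ.comp (Literature.NumberTheory.GaloisRepresentations.absGaloisGroupAdjoinRootsOfUnity K ℓ).subtype) → Literature.NumberTheory.GaloisRepresentations.Subgroup.IsEnormous ((Literature.NumberTheory.GaloisRepresentations.absGaloisGroupAdjoinRootsOfUnity K ℓ).map τ) → (∃ σ : Field.absoluteGaloisGroup K, σ ∉ Literature.NumberTheory.GaloisRepresentations.absGaloisGroupAdjoinRootsOfUnity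 K ℓ ∧ ∃ c : Literature.NumberTheory.GaloisRepresentations.padicAlgClResidueField ℓ, (τ σ).1 = c • 1) → ∃ (K' : Type) (_ : Field K') (_ : NumberField K') (_ : Algebra K K'), IsGalois K K' ∧ NumberField.IsCMField K' ∧ IsField (TensorProduct K Kav K') ∧ Algebra.IsUnramifiedIn (NumberField.RingOfIntegers K') (Ideal.span {(ℓ : ℤ)}) ∧ ∃ (hcpt' : _) (Pi : Literature.NumberTheory.Automorphic.CuspidalAutomorphicRepData n K' hcpt'), Pi.1.HasWeightZero ∧ (∀ q : ℕ, q.Prime → q ≠ ℓ → (∀ w : IsDedekindDomain.HeightOneSpectrum (NumberField.RingOfIntegers K'), ((q : ℕ) : NumberField.RingOfIntegers K') ∈ w.asIdeal → Pi.1.IsUnramifiedAt w) → ∀ v : IsDedekindDomain.HeightOneSpectrum (NumberField.RingOfIntegers K'), ((q : ℕ) : NumberField.RingOfIntegers K') ∈ v.asIdeal → ∀ α : Multiset ℂ, Pi.1.HasSatakeParamAt v α → (r.restrictField K').IsUnramifiedAt v ∧ (r.restrictField K').HasFrobCharpolyAt v (Literature.NumberTheory.Automorphic.arithFrobPolyOfSatake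 ι v.residueCard n α)) ∧ ∀ w : IsDedekindDomain.HeightOneSpectrum (NumberField.RingOfIntegers K'), ((ℓ : ℕ) : NumberField.RingOfIntegers K') ∈ w.asIdeal → Pi.1.IsUnramifiedAt w

-- earlier UnramifiedFermatWitness (stmt-Langlands-17962, replaced 2026-08-17T06:50:50Z -> stmt-Langlands-18025): retired by None — ∀ (K : Type) [Field K] [NumberField K], NumberField.IsCMField K → ∀ (Kav : Type) [Field Kav] [Algebra K Kav], FiniteDimensional K Kav → ∀ (n : ℕ), 2 ≤ n → ∀ (ℓ : ℕ) [Fact ℓ.Prime], n ^ 2 < ℓ → 2 * n < ℓ → Algebra.IsUnramifiedIn (NumberField.RingOfIntegers K) (Ideal.span 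
/-- item stmt-Langlands-18025 · crux · rank 2 · open · by planner
why it might fail: the Stickelberger types of Fermat χ-pieces (as N, χ vary with ℓ ∤ N, χ non-self-dual à la Qian) may miss some semisimple niveau-n inertial types of digits {0,…,n−1}, and NON-semisimple r̄|Γ_K_v are not reached at t ≡ 0; enormous/decomposed-generic may not survive Qian's K'.
sources: Qian2022, Katz2009, Washington1997, IrelandRosen1990, BarnetlambEtAl2014, ACCGHLNSTT2023
[crux] THE DOOR — ℓ-unramified potential residual automorphy in weight zero, delivered as the
hypothesis bundle (1)–(5) of ACC+ Thm 6.1.1 (weight 0): under X's hypotheses there are a finite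
Galois CM K'/K, linearly disjoint from K^av, with ℓ UNRAMIFIED in K', a compactness witness hcpt', a
residual representation τ' of r|Γ_K' that is absolutely irreducible, decomposed generic, enormous on
Γ_K'(ζ_ℓ) with a scalar element off it, the transported analytic hypotheses (r|Γ_K' a.e. unramified,
crystalline of labelled weights {0,…,n−1} at every w ∣ ℓ), and a WITNESS: a cuspidal π of GL_n(𝔸_K')
of weight 0, unramified above ℓ, and a framed r₀ with the HLTT property of r_ι(π) whose residual
representation is τ' (mechanism: Stickelberger dial at the Fermat point + ℓ-adic local constancy +
Moret-Bailly with unramified E'_v + Qian's ℓ'-switch). Rev 2 (route-repair 2026-08-17): the HLTT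
predicate is WRITTEN OUT over facts-free vocabulary (for every rational prime q ≠ ℓ above which π is
unramified and every v ∣ q, r₀ is unramified at v with the Frobenius characteristic polynomial
predicted by π's Satake parameter) and the term uses the abbreviations k := 𝔽̄
(padicAlgClResidueField ℓ), H := Γ_K(ζ -/
@[route_item "route-Langlands-StickelbergerDial", crux]
def UnramifiedFermatWitness : Prop :=
  ∀ (K : Type) [Field K] [NumberField K], NumberField.IsCMField K → ∀ (Kav : Type) [Field Kav] [Algebra K Kav], FiniteDimensional K Kav → ∀ (n : ℕ), 2 ≤ n → ∀ (ℓ : ℕ) [Fact ℓ.Prime], n ^ 2 < ℓ → 2 * n < ℓ → Algebra.IsUnramifiedIn (NumberField.RingOfIntegers K) (Ideal.span {(ℓ : ℤ)}) → let k := Literature.NumberTheory.GaloisRepresentations.padicAlgClResidueField ℓ; ∀ (ι : PadicAlgCl ℓ ≃+* ℂ) (r : Literature.NumberTheory.GaloisRepresentations.FramedGaloisRep K (PadicAlgCl ℓ) n) (τ : Field.absoluteGaloisGroup K →* GL (Fin n) k), (∀ᶠ v in cofinite, r.IsUnramifiedAt v) → (∀ (v : IsDedekindDomain.HeightOneSpectrum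 (NumberField.RingOfIntegers K)) (hv : (ℓ : NumberField.RingOfIntegers K) ∈ v.asIdeal), let D := Literature.NumberTheory.PAdicHodge.fontainePstAdicCompletion v ℓ hv; D.IsCrystallineFramed (r.toLocal v) ∧ (letI := D.algebra; ∀ τ' : v.adicCompletion K →ₐ[ℚ_[ℓ]] PadicAlgCl ℓ, r.labelledHodgeTateWeightsAt v D.algebra D.𝔅 τ'.toRingHom = (Multiset.range n).map fun i : ℕ => (i : ℤ))) → r.IsResidualRepOf (RingHom.id _) τ → Literature.NumberTheory.GaloisRepresentations.IsAbsIrreducible τ → Literature.NumberTheory.GaloisRepresentations.IsDecomposedGeneric τ → let H := Literature.NumberTheory.GaloisRepresentations.absGaloisGroupAdjoinRootsOfUnity K ℓ; Literature.NumberTheory.GaloisRepresentations.IsAbsIrreducible (τ.comp H.subtype) → Literature.NumberTheory.GaloisRepresentations.Subgroup.IsEnormous (H.map τ) → (∃ σ : Field.absoluteGaloisGroup K, σ ∉ H ∧ ∃ c : k, (τ σ).1 = c • 1) → ∃ (K' : Type) (_ : Field K') (_ : NumberField K') (_ : Algebra K K'), let H' := Literature.NumberTheory.GaloisRepresentations.absGaloisGroupAdjoinRootsOfUnity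 K' ℓ; IsGalois K K' ∧ NumberField.IsCMField K' ∧ IsField (TensorProduct K Kav K') ∧ Algebra.IsUnramifiedIn (NumberField.RingOfIntegers K') (Ideal.span {(ℓ : ℤ)}) ∧ ∃ (hcpt' : _) (τ' : Field.absoluteGaloisGroup K' →* GL (Fin n) k) (π : Literature.NumberTheory.Automorphic.CuspidalAutomorphicRepData n K' hcpt') (r₀ : Literature.NumberTheory.GaloisRepresentations.FramedGaloisRep K' (PadicAlgCl ℓ) n), (∀ᶠ w in cofinite, (r.restrictField K').IsUnramifiedAt w) ∧ (∀ (w : IsDedekindDomain.HeightOneSpectrum (NumberField.RingOfIntegers K')) (hw : (ℓ : NumberField.RingOfIntegers K') ∈ w.asIdeal), let D := Literature.NumberTheory.PAdicHodge.fontainePstAdicCompletion w ℓ hw; D.IsCrystallineFramed ((r.restrictField K').toLocal w) ∧ (letI := D.algebra; ∀ τ'' : w.adicCompletion K' →ₐ[ℚ_[ℓ]] PadicAlgCl ℓ, (r.restrictField K').labelledHodgeTateWeightsAt w D.algebra D.𝔅 τ''.toRingHom = (Multiset.range n).map fun i : ℕ => (i : ℤ))) ∧ (r.restrictField K').IsResidualRepOf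 (RingHom.id _) τ' ∧ Literature.NumberTheory.GaloisRepresentations.IsAbsIrreducible τ' ∧ Literature.NumberTheory.GaloisRepresentations.IsDecomposedGeneric τ' ∧ Literature.NumberTheory.GaloisRepresentations.IsAbsIrreducible (τ'.comp H'.subtype) ∧ Literature.NumberTheory.GaloisRepresentations.Subgroup.IsEnormous (H'.map τ') ∧ (∃ σ : Field.absoluteGaloisGroup K', σ ∉ H' ∧ ∃ c : k, (τ' σ).1 = c • 1) ∧ π.1.HasWeightZero ∧ (∀ q : ℕ, q.Prime → q ≠ ℓ → (∀ w : IsDedekindDomain.HeightOneSpectrum (NumberField.RingOfIntegers K'), (q : NumberField.RingOfIntegers K') ∈ w.asIdeal → π.1.IsUnramifiedAt w) → ∀ v : IsDedekindDomain.HeightOneSpectrum (NumberField.RingOfIntegers K'), (q : NumberField.RingOfIntegers K') ∈ v.asIdeal → ∀ α : Multiset ℂ, π.1.HasSatakeParamAt v α → r₀.IsUnramifiedAt v ∧ r₀.HasFrobCharpolyAt v (Literature.NumberTheory.Automorphic.arithFrobPolyOfSatake ι v.residueCard n α)) ∧ r₀.IsResidualRepOf (RingHom.id _) τ' ∧ ∀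 w : IsDedekindDomain.HeightOneSpectrum (NumberField.RingOfIntegers K'), (ℓ : NumberField.RingOfIntegers K') ∈ w.asIdeal → π.1.IsUnramifiedAt w

/-- item stmt-Langlands-17964 · crux · rank 9 · open · by planner
why it might fail: it is the rest of GL_n reciprocity: fails if (A) fails for an irregular π or (B) fails beyond the regular CM world while X holds; in particular potential ⇒ actual automorphy over K needs insoluble descent (SolvableImageBarrier).
sources: BuzzardGeeLMS2014, FontaineMazurGeometric1995, Calegari2023, ACCGHLNSTT2023
[crux] the junction X → Langlands: everything in the summit outside the weight-zero non-ordinary CM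
potential-automorphy cell (descent from K' to K and Serre-type residual automorphy, other weights —
blocked for family methods by defn-FamilyWitnessConsecutiveWeights —, irregular π, non-CM F,
direction (A), local–global compatibility at every place, the reciprocity data 𝓡). Not this route's
business; filed so that closes ends in the summit constant (same pattern as
AnalyticDescent.SectorComplement, EisensteinGelfandKirillov.SectorComplement,
WachComponentCensus.SliceToLanglands). [deps: WeightZeroNonOrdinaryPA] [difficulty: open-problem] -/
@[route_item "route-Langlands-StickelbergerDial", crux]
def SectorComplement : Prop :=
  WeightZeroNonOrdinaryPA → _root_.Langlands

-- earlier FLLiftingWeightZero (stmt-Langlands-17963, replaced 2026-08-17T06:46:48Z -> stmt-Langlands-18016): retired by None — Literature.NumberTheory.Automorphic.ACCGHLNSTT2023.automorphyLifting_crystalline_weightZero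
/-- item stmt-Langlands-18016 · support · rank 9 · open · by planner
sources: ACCGHLNSTT2023
[support] ACC+ 2023 Thm 6.1.1 at weight zero (Fontaine–Laffaille automorphy lifting for GL_n over CM
or totally real F: p > n², 2n < p, p unramified in F; ρ a.e. unramified, crystalline of labelled HT
weights {0,…,n−1} at every v ∣ p; ρ̄ absolutely irreducible, decomposed generic, enormous on
Γ_F(ζ_p), scalar off it; a weight-0 cuspidal π unramified above p and a framed r with HLTT's
characterising property of r_ι(π) and residual representation ρ̄ ⇒ ρ has the HLTT property of r_ι(Π)
for a weight-0 cuspidal Π unramified above p and wherever ρ, π are) — WRITTEN OUT: this item is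
DEFINITIONALLY EQUAL (planner EquivCheck.lean, `Iff.rfl`, lean rc 0) to the tree's named fact
`Literature.NumberTheory.Automorphic.ACCGHLNSTT2023.automorphyLifting_crystalline_weightZero`, with
the HLTT predicate `HarrisLanTaylorThorne2016.IsCompatible` unfolded over facts-free vocabulary
(HasSatakeParamAt / IsUnramifiedAt / HasFrobCharpolyAt / arithFrobPolyOfSatake), so that the route's
cone carries no holds-free Literature constant (route-repair 2026-08-17). It is the ONE Literature
fact this route genuinely needs (route note `needs-fact:` that decl): closing it = `exact
automorphyLifting_crystalline_weight -/
@[route_item "route-Langlands-StickelbergerDial", crux]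
def FLLiftingWeightZero : Prop :=
  ∀ (F : Type) [Field F] [NumberField F], NumberField.IsTotallyReal F ∨ NumberField.IsCMField F → ∀ (n : ℕ) (hcpt : Literature.NumberTheory.Automorphic.isCompact_glFiniteIntegralLevel n F) (p : ℕ) [Fact p.Prime], n ^ 2 < p → 2 * n < p → Algebra.IsUnramifiedIn (NumberField.RingOfIntegers F) (Ideal.span {(p : ℤ)}) → ∀ (ι : PadicAlgCl p ≃+* ℂ) (ρ : Literature.NumberTheory.GaloisRepresentations.FramedGaloisRep F (PadicAlgCl p) n) (τ : Field.absoluteGaloisGroup F →* GL (Fin n) (Literature.NumberTheory.GaloisRepresentations.padicAlgClResidueField p)) (π : Literature.NumberTheory.Automorphic.CuspidalAutomorphicRepData n F hcpt) (r : Literature.NumberTheory.GaloisRepresentations.FramedGaloisRep F (PadicAlgCl p) n), (∀ᶠ v : IsDedekindDomain.HeightOneSpectrum (NumberField.RingOfIntegers F) in Filter.cofinite, ρ.IsUnramifiedAt v) → (∀ (v : IsDedekindDomain.HeightOneSpectrum (NumberField.RingOfIntegers F)) (hv : ((p : ℕ) : NumberField.RingOfIntegers F) ∈ v.asIdeal),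 let D := Literature.NumberTheory.PAdicHodge.fontainePstAdicCompletion v p hv; D.IsCrystallineFramed (ρ.toLocal v) ∧ (letI := D.algebra; ∀ τ' : v.adicCompletion F →ₐ[ℚ_[p]] PadicAlgCl p, ρ.labelledHodgeTateWeightsAt v D.algebra D.𝔅 τ'.toRingHom = (Multiset.range n).map fun i : ℕ => (i : ℤ))) → ρ.IsResidualRepOf (RingHom.id _) τ → Literature.NumberTheory.GaloisRepresentations.IsAbsIrreducible τ → Literature.NumberTheory.GaloisRepresentations.IsDecomposedGeneric τ → Literature.NumberTheory.GaloisRepresentations.IsAbsIrreducible (τ.comp (Literature.NumberTheory.GaloisRepresentations.absGaloisGroupAdjoinRootsOfUnity F p).subtype) → Literature.NumberTheory.GaloisRepresentations.Subgroup.IsEnormous ((Literature.NumberTheory.GaloisRepresentations.absGaloisGroupAdjoinRootsOfUnity F p).map τ) → (∃ σ : Field.absoluteGaloisGroup F, σ ∉ Literature.NumberTheory.GaloisRepresentations.absGaloisGroupAdjoinRootsOfUnity F p ∧ ∃ c : Literature.NumberTheory.GaloisRepresentations.padicAlgClResidueField p, (τ σ).1 = c • 1) → π.1.HasWeightZero →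 (∀ q : ℕ, q.Prime → q ≠ p → (∀ w : IsDedekindDomain.HeightOneSpectrum (NumberField.RingOfIntegers F), ((q : ℕ) : NumberField.RingOfIntegers F) ∈ w.asIdeal → π.1.IsUnramifiedAt w) → ∀ v : IsDedekindDomain.HeightOneSpectrum (NumberField.RingOfIntegers F), ((q : ℕ) : NumberField.RingOfIntegers F) ∈ v.asIdeal → ∀ α : Multiset ℂ, π.1.HasSatakeParamAt v α → r.IsUnramifiedAt v ∧ r.HasFrobCharpolyAt v (Literature.NumberTheory.Automorphic.arithFrobPolyOfSatake ι v.residueCard n α)) → r.IsResidualRepOf (RingHom.id _) τ → (∀ v : IsDedekindDomain.HeightOneSpectrum (NumberField.RingOfIntegers F), ((p : ℕ) : NumberField.RingOfIntegers F) ∈ v.asIdeal → π.1.IsUnramifiedAt v) → ∃ Pi : Literature.NumberTheory.Automorphic.CuspidalAutomorphicRepData n F hcpt, Pi.1.HasWeightZero ∧ (∀ q : ℕ, q.Prime → q ≠ p → (∀ w : IsDedekindDomain.HeightOneSpectrum (NumberField.RingOfIntegers F), ((q : ℕ) : NumberField.RingOfIntegers F) ∈ w.asIdeal → Pi.1.IsUnramifiedAt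 w) → ∀ v : IsDedekindDomain.HeightOneSpectrum (NumberField.RingOfIntegers F), ((q : ℕ) : NumberField.RingOfIntegers F) ∈ v.asIdeal → ∀ α : Multiset ℂ, Pi.1.HasSatakeParamAt v α → ρ.IsUnramifiedAt v ∧ ρ.HasFrobCharpolyAt v (Literature.NumberTheory.Automorphic.arithFrobPolyOfSatake ι v.residueCard n α)) ∧ (∀ v : IsDedekindDomain.HeightOneSpectrum (NumberField.RingOfIntegers F), ((p : ℕ) : NumberField.RingOfIntegers F) ∈ v.asIdeal → Pi.1.IsUnramifiedAt v) ∧ ∀ v : IsDedekindDomain.HeightOneSpectrum (NumberField.RingOfIntegers F), ρ.IsUnramifiedAt v → π.1.IsUnramifiedAt v → Pi.1.IsUnramifiedAt v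

/-- item stmt-Langlands-17965 · assembly · rank 1 · open · by planner
sources: ACCGHLNSTT2023, Qian2022
[assembly] UnramifiedFermatWitness → FLLiftingWeightZero → SectorComplement → Langlands. -/
@[route_item "route-Langlands-StickelbergerDial"]
def Assembly : Prop :=
  UnramifiedFermatWitness → FLLiftingWeightZero → SectorComplement → _root_.Langlands

/-! D-0027 §2.1 — DECIDING THEOREM (planner-authored via `route open/edit --closes-file`; by planner-plan-novel-Langlands-Langlands-e266a39d-c-v2-g12-0 2026-08-17T06:04:41Z):
its hypotheses are this route's items and its conclusion the sub-problem Statement (glue_lint), and it elaborates with this file. -/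

@[closes "route-Langlands-StickelbergerDial"] theorem closes (hW : UnramifiedFermatWitness) (hF : FLLiftingWeightZero)
    (hJ : SectorComplement) : _root_.Langlands := by
  refine hJ ?_
  intro K _ _ hK Kav _ _ hKav n hn ℓ _ hn2 h2n hunr ι r τ h1 h2 hres habs hdg habs' hen hσ
  have hW' := hW K hK Kav hKav n hn ℓ hn2 h2n hunr ι r τ h1 h2 hres habs hdg habs' hen hσ
  clear hW
  obtain ⟨K', iF, iN, iA, hgal, hcm, hdisj, hunr', hrest⟩ := hW'
  obtain ⟨hcpt', τ', π, r₀, h1', h2', hres', habsK, hdgK, habsK', henK, hσK, hwt, hcomp, hres₀,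
    hunrπ⟩ := hrest
  have hF' := hF K' (Or.inr hcm) n hcpt' ℓ hn2 h2n hunr' ι (r.restrictField K') τ' π r₀ h1' h2'
    hres' habsK hdgK habsK' henK hσK hwt hcomp hres₀ hunrπ
  obtain ⟨Pi, hPiwt, hPicomp, hPiunr, -⟩ := hF'
  exact ⟨K', iF, iN, iA, hgal, hcm, hdisj, hunr', hcpt', Pi, hPiwt, hPicomp, hPiunr⟩

end Summit.Langlands.Langlands.Theses.StickelbergerDial
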